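import Mathlib
import Summits.KontsevichZagierPeriods.KontsevichZagierPeriods.Theorems.SoloInformedKappaHomotopy
import HarnessLib

/-!
# Solo-informed: (R3) `κ` of an exact form — Newton–Leibniz along a Nash path

File J3 of the `κ`-side of Rung 2 (`paper/rung2-v2.md` §5, relation (R3)). The Huber–Wüstholz
elementary relation `exact`: `(Z, dP, γ) − (P(γ(1)) − P(γ(0))) · 𝟙`. We prove that the functional
`κ` of `SoloInformedKappaHomotopy.lean` kills it:

* `soloInformed_of_sub_constRep_mem_relations` — **Newton–Leibniz on `[0,1]` over a point**: for a
  `ℚ`-semialgebraic primitive `F` on `[0,1] ⊆ ℝ¹`, continuous on `[0,1]` with derivative the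
  integrand on `(0,1)`, `[[0,1], F′] − [pt, F(1) − F(0)]` is ONE move of `KZ.newtonLeibnizRel`
  (base dimension `0`);
* `soloInformedKappaTilde_exact` — for a Nash path `γ` on `Z` and `P ∈ ℚ̄[x]`,
  `κ̃(Z, dP, γ) = (⟦[pt, Re c]⟧, ⟦[pt, Im c]⟧)` with `c = P(γ(1)) − P(γ(0))`: the path integrand of
  `dP` is `d/dt P(γ(t))` (chain rule, `CurvePeriods.hasDerivWithinAt_eval_comp`), its real and
  imaginary parts are `ℚ`-semialgebraic on `[0,1]` because `γ` is Nash, and Newton–Leibniz applies;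
* `soloInformed_isNashPath_unitPath`, `soloInformedKappaTilde_unit` — the unit path `t ↦ t` on `𝔸¹`
  is Nash and `κ̃(𝟙) = (1, 0)`;
* `soloInformedKappa_exact` — **(R3)**: `κ(Z, dP, γ) = c • κ(𝟙)` for EVERY `C¹` path `γ`
  (`κ(Z, dP, γ) = κ̃(Z, dP, N(Z,γ))` and the Nash replacement `N(Z, γ)` has the same end points).

References: Kontsevich–Zagier, *Periods* (2001) §1.2 rule (3); Huber–Wüstholz, *Transcendence and
linear relations of 1-periods* (2022), Ch. 13 (the relation `exact` of Thm. 13.3).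
-/

noncomputable section

open scoped unitInterval
open MeasureTheory Set MvPolynomial
open Literature.NumberTheory.Transcendental Literature.NumberTheory.Transcendental.KZ
open Literature.NumberTheory.Transcendental.CurvePeriods
open Literature.ModelTheory.ExponentialFields

namespace Summit.KontsevichZagierPeriods.KontsevichZagierPeriods.Theorems

/-! ## 1. Newton–Leibniz on `[0, 1]` over a point -/

/-- **Newton–Leibniz on `[0, 1]` over a point.** If `r.domain = [0,1] ⊆ ℝ¹`, `F` is
`ℚ`-semialgebraic on it, `t ↦ F(t)` is continuous on `[0, 1]` and has derivative `r.integrand (t)`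
at every `t ∈ (0, 1)`, then `[r] − [pt, F(1) − F(0)]` is one Newton–Leibniz move.
[Kontsevich–Zagier 2001, §1.2 rule (3)] -/
theorem soloInformed_of_sub_constRep_mem_relations (r : IntegralRep 1)
    (hr : r.domain = soloInformedUnitI) (F : (Fin 1 → ℝ) → ℝ)
    (hF : IsSemialgebraicFunOn ℚ r.domain F)
    (hFc : ContinuousOn (fun t : ℝ => F (fun _ => t)) (Icc (0 : ℝ) 1))
    (hFd : ∀ t ∈ Ioo (0 : ℝ) 1,
      HasDerivAt (fun u : ℝ => F (fun _ => u)) (r.integrand (fun _ => t)) t)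
    {c : ℝ} (hc : IsAlgebraic ℚ c) (hcF : c = F (fun _ => 1) - F (fun _ => 0)) :
    of r - of (soloInformedConstRep c hc) ∈ relations := by
  have soloInformed_snoc_fin0 (x : Fin 0 → ℝ) (t : ℝ) :
      (Fin.snoc x t : Fin 1 → ℝ) = fun _ => t := by
    funext i
    have hi : i = Fin.last 0 := Subsingleton.elim (α := Fin 1) _ _
    rw [hi]
    exact Fin.snoc_last (α := fun _ => ℝ) (x := t) (p := x)
  refine newtonLeibnizRel_subset_relations ⟨0, r, soloInformedConstRep c hc, fun _ => 0,
    fun _ => 1, F, hF, ?_, ?_, fun _ _ => zero_le_one, ?_, ?_, ?_, ?_, rfl⟩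
  · exact isSemialgebraicFunOn_const_of_isAlgebraic isSemialgebraic_univ isAlgebraic_zero
  · exact isSemialgebraicFunOn_const_of_isAlgebraic isSemialgebraic_univ isAlgebraic_one
  · rw [hr]
    ext z
    simp only [soloInformedUnitI, mem_setOf_eq, soloInformedConstRep_domain, mem_univ, true_and]
    exact Iff.rfl
  · intro x _
    simpa only [soloInformed_snoc_fin0] using hFc
  · intro x _ t ht
    simpa only [soloInformed_snoc_fin0] using hFd t ht
  · intro x _
    simpa only [soloInformed_snoc_fin0, soloInformedConstRep_integrand] using hcF

/-- Corollary: under the hypotheses of `soloInformed_of_sub_constRep_mem_relations`,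
`⟦r⟧ = ⟦[pt, F(1) − F(0)]⟧` in `P`. -/
theorem soloInformed_toFormalPeriod_eq_constRep (r : IntegralRep 1)
    (hr : r.domain = soloInformedUnitI) (F : (Fin 1 → ℝ) → ℝ)
    (hF : IsSemialgebraicFunOn ℚ r.domain F)
    (hFc : ContinuousOn (fun t : ℝ => F (fun _ => t)) (Icc (0 : ℝ) 1))
    (hFd : ∀ t ∈ Ioo (0 : ℝ) 1,
      HasDerivAt (fun u : ℝ => F (fun _ => u)) (r.integrand (fun _ => t)) t)
    {c : ℝ} (hc : IsAlgebraic ℚ c) (hcF : c = F (fun _ => 1) - F (fun _ => 0)) :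
    toFormalPeriod (of r) = toFormalPeriod (of (soloInformedConstRep c hc)) :=
  toFormalPeriod_eq_iff.2 (soloInformed_of_sub_constRep_mem_relations r hr F hF hFc hFd hc hcF)

/-! ## 2. The chain rule along a path -/

/-- **Chain rule.** Along a path which is `C¹` on an open interval, `t ↦ P(γ(t))` has derivative
`Σᵢ ∂ᵢP(γ(t)) γᵢ′(t)` at every point of the interval. [folklore] -/
theorem soloInformed_hasDerivAt_eval_path {n : ℕ} {γ : ℝ → Fin n → ℂ} {a b : ℝ}
    (hd : ContDiffOn ℝ 1 γ (Ioo a b)) (P : MvPolynomial (Fin n) ℂ) {t : ℝ} (ht : t ∈ Ioo a b) :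
    HasDerivAt (fun u => eval (γ u) P)
      (∑ i, eval (γ t) (pderiv i P) * deriv (fun u => γ u i) t) t := by
  have h := hasDerivWithinAt_eval_comp (s := univ) (t := t)
    (fun i => ((soloInformed_differentiableAt_coord hd ht i).hasDerivAt).hasDerivWithinAt) P
  exact hasDerivWithinAt_univ.mp h

/-- The path integrand of the symbol `(Z, dP, γ)` is `Σᵢ ∂ᵢP(γ(t)) γᵢ′(t)` (definitional). -/
theorem soloInformedPathIntegrand_formD (Z : CurveData) (hZ : Z.IsSmoothAffineCurve)
    (γ : CurvePath Z) (P : MvPolynomial (Fin Z.n) ℂ) (h : ∀ i, HasAlgCoeffs (formD P i)) (t : ℝ) :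
    soloInformedPathIntegrand ⟨Z, hZ, formD P, h, γ⟩ t =
      ∑ i, eval (γ.toFun t) (pderiv i P) * deriv (fun u => γ.toFun u i) t := rfl

/-- Real part of a derivative: `(Re ∘ φ)′ = Re φ′`. -/
theorem soloInformed_hasDerivAt_re {φ : ℝ → ℂ} {φ' : ℂ} {t : ℝ} (h : HasDerivAt φ φ' t) :
    HasDerivAt (fun u => (φ u).re) φ'.re t := by
  simpa [Function.comp_def] using Complex.reCLM.hasFDerivAt.comp_hasDerivAt t h

/-- Imaginary part of a derivative: `(Im ∘ φ)′ = Im φ′`. -/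
theorem soloInformed_hasDerivAt_im {φ : ℝ → ℂ} {φ' : ℂ} {t : ℝ} (h : HasDerivAt φ φ' t) :
    HasDerivAt (fun u => (φ u).im) φ'.im t := by
  simpa [Function.comp_def] using Complex.imCLM.hasFDerivAt.comp_hasDerivAt t h

/-! ## 3. `κ̃` of an exact form along a Nash path -/

/-- **`κ̃(Z, dP, γ) = (⟦[pt, Re c]⟧, ⟦[pt, Im c]⟧)`, `c = P(γ(1)) − P(γ(0))`**, for a Nash path `γ`
and `P` with algebraic coefficients: two Newton–Leibniz moves (real and imaginary parts of
`t ↦ P(γ(t))` as primitives).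
[Kontsevich–Zagier 2001, §1.2 rule (3); Huber–Wüstholz 2022, Ch. 13] -/
theorem soloInformedKappaTilde_exact (Z : CurveData) (hZ : Z.IsSmoothAffineCurve) (γ : CurvePath Z)
    (hN : SoloInformedIsNashPath γ.toFun) (P : MvPolynomial (Fin Z.n) ℂ) (hP : HasAlgCoeffs P)
    (ω : Fin Z.n → MvPolynomial (Fin Z.n) ℂ) (h : ∀ i, HasAlgCoeffs (ω i)) (hω : ω = formD P)
    {a b : ℝ} (ha : IsAlgebraic ℚ a) (hb : IsAlgebraic ℚ b)
    (hac : a = (eval (γ.toFun 1) P).re - (eval (γ.toFun 0) P).re)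
    (hbc : b = (eval (γ.toFun 1) P).im - (eval (γ.toFun 0) P).im) :
    soloInformedKappaTilde ⟨Z, hZ, ω, h, γ⟩ hN =
      SoloInformedV.mk (toFormalPeriod (of (soloInformedConstRep a ha)))
        (toFormalPeriod (of (soloInformedConstRep b hb))) := by
  subst hω
  obtain ⟨ε, hε, hcd, hsa⟩ := id hN
  have hε' : (0 : ℝ) < ε := by exact_mod_cast hε
  have hs := isSemialgebraic_soloInformedIoo1 (-ε) (1 + ε)
  push_cast at hs
  have hPsa : SoloInformedReImSA (soloInformedIoo1 (-(ε : ℝ)) (1 + ε))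
      (fun x => eval (γ.toFun (x 0)) P) := SoloInformedReImSA.eval_poly hs hsa hP
  have hPsaI := hPsa.mono (soloInformedUnitI_subset_Ioo1 hε') isSemialgebraic_soloInformedUnitI
  have hPc : ContinuousOn (fun t : ℝ => eval (γ.toFun t) P) (Icc (0 : ℝ) 1) :=
    (continuous_eval P).comp_continuousOn γ.contDiffOn.continuousOn
  have hPd : ∀ t ∈ Ioo (0 : ℝ) 1, HasDerivAt (fun u => eval (γ.toFun u) P)
      (soloInformedPathIntegrand ⟨Z, hZ, formD P, h, γ⟩ t) t := fun t ht => by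
    rw [soloInformedPathIntegrand_formD]
    exact soloInformed_hasDerivAt_eval_path hcd P ⟨by linarith [ht.1], by linarith [ht.2]⟩
  ext
  · rw [soloInformedKappaTilde_fst, SoloInformedV.fst_mk]
    refine soloInformed_toFormalPeriod_eq_constRep _ rfl (fun x => (eval (γ.toFun (x 0)) P).re)
      hPsaI.1 (Complex.continuous_re.comp_continuousOn hPc) (fun t ht => ?_) ha hac
    simpa only [soloInformedPathRepRe_integrand] using soloInformed_hasDerivAt_re (hPd t ht)
  · rw [soloInformedKappaTilde_snd, SoloInformedV.snd_mk]
    refine soloInformed_toFormalPeriod_eq_constRep _ rfl (fun x => (eval (γ.toFun (x 0)) P).im)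
      hPsaI.2 (Complex.continuous_im.comp_continuousOn hPc) (fun t ht => ?_) hb hbc
    simpa only [soloInformedPathRepIm_integrand] using soloInformed_hasDerivAt_im (hPd t ht)

/-! ## 4. The unit symbol -/

/-- Nash data of the unit path `t ↦ t` on `𝔸¹`, on every interval `(−ε, 1 + ε)`. -/
theorem soloInformed_nashData_unitPath (ε : ℚ) :
    ContDiffOn ℝ 1 unitPath.toFun (Ioo (-(ε : ℝ)) (1 + ε)) ∧
      ∀ i, SoloInformedReImSA (soloInformedIoo1 (-(ε : ℝ)) (1 + ε))
        (fun t => unitPath.toFun (t 0) i) := by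
  have hs := isSemialgebraic_soloInformedIoo1 (-ε) (1 + ε)
  push_cast at hs
  refine ⟨(contDiff_pi' fun _ => Complex.ofRealCLM.contDiff).contDiffOn, fun i => ⟨?_, ?_⟩⟩
  · exact (isSemialgebraicFunOn_aeval hs (X 0 : MvPolynomial (Fin 1) ℚ)).congr fun x _ => by
      simp [unitPath]
  · exact (isSemialgebraicFunOn_const_of_isAlgebraic hs isAlgebraic_zero).congr fun x _ => by
      simp [unitPath]

/-- **The unit path is a Nash path.** -/
theorem soloInformed_isNashPath_unitPath : SoloInformedIsNashPath PeriodSymbol.unit.γ.toFun :=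
  ⟨1, one_pos, (soloInformed_nashData_unitPath 1).1, (soloInformed_nashData_unitPath 1).2⟩

/-- The path integrand of the unit symbol is the constant `1`. -/
theorem soloInformedPathIntegrand_unit (t : ℝ) :
    soloInformedPathIntegrand PeriodSymbol.unit t = 1 := by
  have hderiv : deriv (fun u : ℝ => (u : ℂ)) t = 1 := by
    have e : (fun u : ℝ => (u : ℂ)) = ⇑Complex.ofRealCLM := by funext u; simp
    rw [e, (Complex.ofRealCLM.hasDerivAt (x := t)).deriv]
    simp
  show (∑ i : Fin 1, eval (fun _ : Fin 1 => (t : ℂ)) (1 : MvPolynomial (Fin 1) ℂ) *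
      deriv (fun u : ℝ => (fun _ : Fin 1 => (u : ℂ)) i) t) = 1
  rw [Fin.sum_univ_one, map_one, one_mul]
  exact hderiv

/-- **`κ̃(𝟙) = (1, 0)`**: `[[0,1], 1] ≡ [pt, 1]` (Newton–Leibniz with primitive `t`) and
`[[0,1], 0] ≡ 0`. -/
theorem soloInformedKappaTilde_unit (hN : SoloInformedIsNashPath PeriodSymbol.unit.γ.toFun) :
    soloInformedKappaTilde PeriodSymbol.unit hN = SoloInformedV.mk 1 0 := by
  ext
  · rw [soloInformedKappaTilde_fst, SoloInformedV.fst_mk, ← toFormalPeriod_of_unit,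
      ← soloInformedConstRep_one]
    refine soloInformed_toFormalPeriod_eq_constRep _ rfl (fun x => x 0)
      (isSemialgebraicFunOn_aeval isSemialgebraic_soloInformedUnitI (X 0 : MvPolynomial (Fin 1) ℚ)
        |>.congr fun x _ => by simp) continuousOn_id (fun t ht => ?_) isAlgebraic_one (by norm_num)
    simp only [soloInformedPathRepRe_integrand, soloInformedPathIntegrand_unit, Complex.one_re]
    exact hasDerivAt_id' t
  · rw [soloInformedKappaTilde_snd, SoloInformedV.snd_mk]
    refine toFormalPeriod_eq_zero_of_mem (of_mem_relations_of_eqOn_zero _ fun x _ => ?_)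
    simp only [soloInformedPathRepIm_integrand, soloInformedPathIntegrand_unit, Complex.one_im,
      Pi.zero_apply]

/-! ## 5. (R3) for `κ` -/

/-- **`κ(𝟙) = (1, 0)`** (under (APPROX) and (HI)). -/
theorem soloInformedKappa_unit (hA : SoloInformedNashApprox) (hI : SoloInformedNashHI) :
    soloInformedKappa hA PeriodSymbol.unit = SoloInformedV.mk 1 0 := by
  rw [soloInformedKappa_eq_kappaTilde hA hI _ soloInformed_isNashPath_unitPath,
    soloInformedKappaTilde_unit]

/-- **(R3) `κ` kills the relation `exact`.** For every smooth affine curve `Z` over `ℚ̄`, every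
`C¹` path `γ` on `Z` with algebraic end points and every `P ∈ ℚ̄[x₁,…,xₙ]`:
`κ(Z, dP, γ) = (P(γ(1)) − P(γ(0))) • κ(𝟙)`. [Huber–Wüstholz 2022, Thm. 13.3 (relation `exact`);
Kontsevich–Zagier 2001, §1.2 rule (3)] -/
theorem soloInformedKappa_exact (hA : SoloInformedNashApprox) (hI : SoloInformedNashHI)
    (Z : CurveData) (hZ : Z.IsSmoothAffineCurve) (γ : CurvePath Z)
    (P : MvPolynomial (Fin Z.n) ℂ) (hP : HasAlgCoeffs P)
    (ω : Fin Z.n → MvPolynomial (Fin Z.n) ℂ) (h : ∀ i, HasAlgCoeffs (ω i)) (hω : ω = formD P)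
    (c : SoloInformedCxAlg) (hc : (c : ℂ) = eval (γ.toFun 1) P - eval (γ.toFun 0) P) :
    soloInformedKappa hA ⟨Z, hZ, ω, h, γ⟩ = c • soloInformedKappa hA PeriodSymbol.unit := by
  rw [soloInformedKappa_unit hA hI, soloInformedKappa_mk]
  have hN := soloInformedNashRepl_nash hA hZ γ
  have h0 : (soloInformedNashRepl hA hZ γ).toFun 0 = γ.toFun 0 :=
    (soloInformedNashRepl_homotopic hA hZ γ).toFun_zero.symm
  have h1 : (soloInformedNashRepl hA hZ γ).toFun 1 = γ.toFun 1 :=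
    (soloInformedNashRepl_homotopic hA hZ γ).toFun_one.symm
  have hre : ((c.re : SoloInformedRealAlg) : ℝ) =
      (eval ((soloInformedNashRepl hA hZ γ).toFun 1) P).re -
        (eval ((soloInformedNashRepl hA hZ γ).toFun 0) P).re := by
    rw [h0, h1, SoloInformedCxAlg.coe_re, hc, Complex.sub_re]
  have him : ((c.im : SoloInformedRealAlg) : ℝ) =
      (eval ((soloInformedNashRepl hA hZ γ).toFun 1) P).im -
        (eval ((soloInformedNashRepl hA hZ γ).toFun 0) P).im := by
    rw [h0, h1, SoloInformedCxAlg.coe_im, hc, Complex.sub_im]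
  rw [soloInformedKappaTilde_exact Z hZ _ hN P hP ω h hω (c.re).isAlgebraic (c.im).isAlgebraic
    hre him]
  ext
  · rw [SoloInformedV.fst_mk, SoloInformedV.fst_smul, SoloInformedV.fst_mk, SoloInformedV.snd_mk,
      smul_zero, sub_zero, soloInformed_smul_def, mul_one, soloInformedAlgScalar_def]
  · rw [SoloInformedV.snd_mk, SoloInformedV.snd_smul, SoloInformedV.fst_mk, SoloInformedV.snd_mk,
      smul_zero, add_zero, soloInformed_smul_def, mul_one, soloInformedAlgScalar_def]

end Summit.KontsevichZagierPeriods.KontsevichZagierPeriods.Theorems
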